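import Summits.BirchSwinnertonDyer.BirchSwinnertonDyer.Theorems.ThetaPartnerAtTwoSignedKatoUpToAtTwoPlusHondaLogCharSum
import Summits.BirchSwinnertonDyer.BirchSwinnertonDyer.Theorems.ThetaPartnerAtTwoSignedKatoUpToAtTwoLocalCyclotomicVariable
import Summits.BirchSwinnertonDyer.BirchSwinnertonDyer.Theorems.ThetaPartnerAtTwoSignedKatoUpToAtTwoHondaLogCharSumsUnits
import Summits.BirchSwinnertonDyer.BirchSwinnertonDyer.Theorems.ThetaPartnerAtTwoSignedControlAtTwoPlusLayerTwoPoints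
import Literature.NumberTheory.EllipticCurves.PAdicLFunctionInterpolationProofs
import HarnessLib

/-!
# Route `ThetaPartnerAtTwo` (TP2), crux K3 `SignedKatoDivisibilityUpToAtTwo` (stmt-BirchSwinnertonDyer-20308 / K3P′ 25631), line
# `colemanrat` v12 → v13 — brick B5a of the lead's assembly memo `G7-ASSEMBLY-v1`: the `P`-SIDE FACTORISATION of Kobayashi's Prop. 8.25
# on THE layer pairing, read through the Bloch–Kato clause (C6): «`Σ_{j<2ⁿ} ψ(5)ʲ·⟨s_n, gʲ•d_n⟩ = [Σ_j ψ(5)ʲ Λ(T⁻¹(g₀ʲ•Q))]·[Σ_b ψ̄(b) τ_b•E]`»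

Lead prover `bsd-wall-tp2-p2x` g7 (cell `bsd-wall`). HONEST FRAMING: theorems only (no definition, no named fact, no instance, no
`sorry`); Galois bookkeeping on the `2`-adic cyclotomic layers `ℚ₂(ζ_{2^m}) = layer 2 m ⊂ ℚ̄₂`; closes no item; K3 / K3P′ are NOT settled
and BSD is NOT proved by any of this.

## What

In the K3 endgame (memo `Cruxes/SignedKatoDivisibilityUpToAtTwo/G7-ASSEMBLY-v1.md` §0) the values of Kurihara's element at an even character,
`χ(P_{n,d_n}(z)) = Σ_{j<2ⁿ} χ(5)ʲ ⟨z_n, gʲ•d_n⟩`, are computed from the Bloch–Kato clause (C6) «`⟨z_n, Q⟩ = Tr_{ℚ₂(ζ_{2^{n+2}})/ℚ₂}(log_ω Q · E)`»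
(`E = exp*_ω`, the trace written as `Σ_{b ∈ (ℤ/2^{n+2})ˣ} τ_b•(·)` with `τ_b ζ = ζ^b`). This file proves the resulting FACTORISATION
(Kobayashi 2003, Prop. 8.25, `P_{n,x}(z) = (Σ_σ log x^σ σ)(Σ_σ exp*(z^σ) σ⁻¹)`) in the tree's enumerations:

* §1 log equivariance on the `2`-adic model: `Λ(T⁻¹(ρ•Q)) = ρ•Λ(T⁻¹Q)` and `T⁻¹(ρ•Q) ∈ E₁` for `T⁻¹Q ∈ E₁` (`ptLogΩ_act` for the transported
  action `T⁻¹∘ρ∘T`);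
* §2 layer bookkeeping: the logarithm `L = Λ(T⁻¹Q)` of a point `Q ∈ E(ℚ_{2,n})` (with `T⁻¹Q ∈ E₁`) lies in `layer 2 (n+2)` and is fixed by
  `Gal(ℚ̄₂/ℚ_{2,n})`, so `τ_{−a}•L = τ_a•L`; products `τ_b τ_a` act on `layer 2 (n+2)` as `τ_{ba}`; `g₀ʲ` acts as `τ_{5ʲ}` when `g₀ʲ ζ = ζ^{5ʲ}`;
* §3 **`sum_pow_mul_trace_eq_mul`**: for `L₀ ∈` (layer, `ℚ_{2,n}`-fixed), `E ∈ layer 2 (n+2)`, an even Dirichlet character `ψ` mod `2^{n+2}`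
  with values in `ℚ̄₂` and the orbit `L_j = g₀ʲ•L₀`:
  `Σ_{s mod 2ⁿ} ψ(5)^s · Σ_{b∈(ℤ/2^{n+2})ˣ} τ_b•(L_s·E) = (Σ_{s mod 2ⁿ} ψ(5)^s·L_s) · Σ_{b∈(ℤ/2^{n+2})ˣ} ψ⁻¹(b)·τ_b•E`
  (w2's `⟨5⟩`-enumeration `HondaLogChi.sum_mulChar_eq_sum_pow_five_of_even` twice, reindexing `a ↦ ba`, and `char ℚ̄₂ = 0`);
The lead's socket `coreChiPrim_of_coreKBK` reads the Bloch–Kato clause (C6) into the left side of §3 through §1 (`L_j = Λ(T⁻¹(g₀ʲ•Q)) =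
g₀ʲ•Λ(T⁻¹Q)`), with `L₀ = Λ(T⁻¹(d₀ n))` for the displayed plus Honda point (§2 supplies its two hypotheses); the log factor is then w4's
(R3-enum) / `PlusLayer.sum_mul_ptLogΩ_smul_plusHondaPoint_eq`, the `E`-factor is Kato's character sum `Σ_b ψ̄(b)σ_b(x_{n+2,∅})` read `2`-adically.

References: [Kobayashi2003] S. Kobayashi, Invent. Math. 152 (2003), §8.4, (8.23), Prop. 8.25 (p. 24), (8.29); [Kato2004Asterisque] Thm. 12.5 (1);
[BlochKato1990] §3 (3.10.1), (3.11.1); [Washington1997] §13.1 (`ℚ_n = ℚ(ζ_{2^{n+2}})⁺`).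
-/

set_option autoImplicit false
-- the Theorems namespace of this sub repeats the summit name by design (D-0017 nested layout)
set_option linter.dupNamespace false

noncomputable section

open scoped Classical IntermediateField NumberField

namespace Summit.BirchSwinnertonDyer.BirchSwinnertonDyer.Theorems.SignedKatoOffTwo.KatoBK

open Field WeierstrassCurve NumberField IsDedekindDomain Literature.NumberTheory.EllipticCurves
  Literature.NumberTheory.GaloisRepresentations
  Literature.NumberTheory.EllipticCurves.ZpExtension Literature.NumberTheory.EllipticCurves.Kobayashi2003
  Literature.NumberTheory.EllipticCurves.FormalGroupChart Literature.NumberTheory.EllipticCurves.Rank1Residual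
  Summit.BirchSwinnertonDyer.Rank1Residual.Additive Summit.BirchSwinnertonDyer.Rank1Residual.Additive.PadicCyclotomicTower
  Summit.BirchSwinnertonDyer.Rank1Residual.Additive.BallEval
  Summit.BirchSwinnertonDyer.BirchSwinnertonDyer.Theorems.SignedKatoOffTwo.LocalTwo

/-! ## §1 Log equivariance on the `2`-adic model -/

section LogEquivariance

variable (W : WeierstrassCurve ℚ) [W.IsGloballyMinimal]

/-- **`T⁻¹(ρ • Q) ∈ E₁`** when `T⁻¹ Q ∈ E₁` (`T = toLoc`, the transported action is an isometry). [cite: Kobayashi2003, §8.4] -/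
theorem toLoc_symm_smul_mem_kernel (ρ : Field.absoluteGaloisGroup ℚ_[2]) (Q : localPoints W ℚ_[2])
    (hQ : haveI := isIntegral_genFib_baseChange 2 ((integralModelInt W).map (Int.castRingHom ℤ_[2]))
      (toLoc ((genFibΩ_eq_baseChange ((integralModelInt W).map (Int.castRingHom ℤ_[2]))).trans
        (baseChange_twoAdicModel W))).symm Q ∈
        kernel (Valued.v (R := PadicAlgCl 2)) (genFibΩ 2 ((integralModelInt W).map (Int.castRingHom ℤ_[2])))) :
    haveI := isIntegral_genFib_baseChange 2 ((integralModelInt W).map (Int.castRingHom ℤ_[2]))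
    (toLoc ((genFibΩ_eq_baseChange ((integralModelInt W).map (Int.castRingHom ℤ_[2]))).trans
        (baseChange_twoAdicModel W))).symm (ρ • Q) ∈
      kernel (Valued.v (R := PadicAlgCl 2)) (genFibΩ 2 ((integralModelInt W).map (Int.castRingHom ℤ_[2]))) := by
  set M : WeierstrassCurve ℤ_[2] := (integralModelInt W).map (Int.castRingHom ℤ_[2]) with hM
  haveI hintΩ := isIntegral_genFib_baseChange 2 M
  set hV := (genFibΩ_eq_baseChange M).trans (baseChange_twoAdicModel W) with hVdef
  set act : Field.absoluteGaloisGroup ℚ_[2] → (genFibΩ 2 M).toAffine.Point → (genFibΩ 2 M).toAffine.Point :=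
    fun σ P ↦ (toLoc hV).symm (σ • toLoc hV P) with hact
  have h : (toLoc hV).symm (ρ • Q) = act ρ ((toLoc hV).symm Q) := by
    rw [hact]; simp only [AddEquiv.apply_symm_apply]
  have key : act ρ ((toLoc hV).symm Q) ∈ kernel (Valued.v (R := PadicAlgCl 2)) (genFibΩ 2 M) :=
    act_mem_kernel act (act_zero hV) (act_some hV) ρ hQ
  rw [h]
  exact @key

/-- **`Λ(T⁻¹(ρ • Q)) = ρ • Λ(T⁻¹ Q)`** for `T⁻¹ Q ∈ E₁` (`ptLogΩ_act` for `act = T⁻¹ ∘ ρ ∘ T`): the formal logarithm is Galois-equivariant.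
[cite: Kobayashi2003, §8.4] -/
theorem ptLogΩ_toLoc_symm_smul (ρ : Field.absoluteGaloisGroup ℚ_[2]) (Q : localPoints W ℚ_[2])
    (hQ : haveI := isIntegral_genFib_baseChange 2 ((integralModelInt W).map (Int.castRingHom ℤ_[2]))
      (toLoc ((genFibΩ_eq_baseChange ((integralModelInt W).map (Int.castRingHom ℤ_[2]))).trans
        (baseChange_twoAdicModel W))).symm Q ∈
        kernel (Valued.v (R := PadicAlgCl 2)) (genFibΩ 2 ((integralModelInt W).map (Int.castRingHom ℤ_[2])))) :
    haveI := isIntegral_genFib_baseChange 2 ((integralModelInt W).map (Int.castRingHom ℤ_[2]))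
    ptLogΩ 2 ((integralModelInt W).map (Int.castRingHom ℤ_[2]))
        ((toLoc ((genFibΩ_eq_baseChange ((integralModelInt W).map (Int.castRingHom ℤ_[2]))).trans
          (baseChange_twoAdicModel W))).symm (ρ • Q)) =
      ρ • ptLogΩ 2 ((integralModelInt W).map (Int.castRingHom ℤ_[2]))
        ((toLoc ((genFibΩ_eq_baseChange ((integralModelInt W).map (Int.castRingHom ℤ_[2]))).trans
          (baseChange_twoAdicModel W))).symm Q) := by
  set M : WeierstrassCurve ℤ_[2] := (integralModelInt W).map (Int.castRingHom ℤ_[2]) with hM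
  haveI hintΩ := isIntegral_genFib_baseChange 2 M
  set hV := (genFibΩ_eq_baseChange M).trans (baseChange_twoAdicModel W) with hVdef
  set act : Field.absoluteGaloisGroup ℚ_[2] → (genFibΩ 2 M).toAffine.Point → (genFibΩ 2 M).toAffine.Point :=
    fun σ P ↦ (toLoc hV).symm (σ • toLoc hV P) with hact
  have h : (toLoc hV).symm (ρ • Q) = act ρ ((toLoc hV).symm Q) := by
    rw [hact]; simp only [AddEquiv.apply_symm_apply]
  rw [h]
  exact ptLogΩ_act act (act_zero hV) (act_some hV) ρ (norm_zCoord_lt_one_of_mem_kernel hQ)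

/-- Iterated form: `Λ(T⁻¹(ρʲ • Q)) = ρʲ • Λ(T⁻¹ Q)`. [cite: Kobayashi2003, §8.4] -/
theorem ptLogΩ_toLoc_symm_pow_smul (ρ : Field.absoluteGaloisGroup ℚ_[2]) (j : ℕ) (Q : localPoints W ℚ_[2])
    (hQ : haveI := isIntegral_genFib_baseChange 2 ((integralModelInt W).map (Int.castRingHom ℤ_[2]))
      (toLoc ((genFibΩ_eq_baseChange ((integralModelInt W).map (Int.castRingHom ℤ_[2]))).trans
        (baseChange_twoAdicModel W))).symm Q ∈
        kernel (Valued.v (R := PadicAlgCl 2)) (genFibΩ 2 ((integralModelInt W).map (Int.castRingHom ℤ_[2])))) :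
    haveI := isIntegral_genFib_baseChange 2 ((integralModelInt W).map (Int.castRingHom ℤ_[2]))
    ptLogΩ 2 ((integralModelInt W).map (Int.castRingHom ℤ_[2]))
        ((toLoc ((genFibΩ_eq_baseChange ((integralModelInt W).map (Int.castRingHom ℤ_[2]))).trans
          (baseChange_twoAdicModel W))).symm (ρ ^ j • Q)) =
      ρ ^ j • ptLogΩ 2 ((integralModelInt W).map (Int.castRingHom ℤ_[2]))
        ((toLoc ((genFibΩ_eq_baseChange ((integralModelInt W).map (Int.castRingHom ℤ_[2]))).trans
          (baseChange_twoAdicModel W))).symm Q) :=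
  ptLogΩ_toLoc_symm_smul W (ρ ^ j) Q hQ

end LogEquivariance

/-! ## §2 Layer bookkeeping: where the logarithm lives, and how the `τ_a` compose on a layer -/

section Layer

/-- `ζ_{2^m}^{x} = ζ_{2^m}^{x % 2^m}`. [folklore] -/
theorem zeta_pow_eq_pow_mod (m x : ℕ) : zeta 2 m ^ x = zeta 2 m ^ (x % 2 ^ m) := by
  conv_lhs => rw [← Nat.mod_add_div x (2 ^ m), pow_add, pow_mul, (isPrimitiveRoot_zeta 2 m).pow_eq_one, one_pow, mul_one]

/-- **`τ_b τ_a` acts on `layer 2 m` as `τ_{ba}`**: if `τ_c ζ_{2^m} = ζ_{2^m}^c` on units `c`, then for units `a b` and `x ∈ ℚ₂(ζ_{2^m})`,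
`τ_b • (τ_a • x) = τ_{ba} • x` (both act on `ζ_{2^m}` by `ζ ↦ ζ^{ba}`; `LocalVar.smul_eq_smul_of_smul_zeta_eq`). [cite: Kobayashi2003, §8.4] -/
theorem smul_smul_eq_smul_mul {m : ℕ} [NeZero (2 ^ m)] (τ : ZMod (2 ^ m) → Field.absoluteGaloisGroup ℚ_[2])
    (hτ : ∀ a : ZMod (2 ^ m), IsUnit a → τ a • zeta 2 m = zeta 2 m ^ a.val)
    {a b : ZMod (2 ^ m)} (ha : IsUnit a) (hb : IsUnit b) {x : PadicAlgCl 2} (hx : x ∈ layer 2 m) :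
    τ b • (τ a • x) = τ (b * a) • x := by
  rw [← mul_smul]
  refine LocalVar.smul_eq_smul_of_smul_zeta_eq 2 ?_ hx
  rw [mul_smul, hτ a ha, smul_pow', hτ b hb, ← pow_mul, hτ (b * a) (hb.mul ha), ZMod.val_mul,
    ← zeta_pow_eq_pow_mod]

/-- **`g₀ʲ` acts on `layer 2 m` as `τ_{5ʲ}`** when `g₀ʲ ζ_{2^m} = ζ_{2^m}^{5ʲ}`. [cite: Kobayashi2003, §8.4] -/
theorem pow_smul_eq_tau_smul {m : ℕ} [NeZero (2 ^ m)] (τ : ZMod (2 ^ m) → Field.absoluteGaloisGroup ℚ_[2])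
    (hτ : ∀ a : ZMod (2 ^ m), IsUnit a → τ a • zeta 2 m = zeta 2 m ^ a.val)
    {g₀ : Field.absoluteGaloisGroup ℚ_[2]} (hg₀ : ∀ j : ℕ, g₀ ^ j • zeta 2 m = zeta 2 m ^ 5 ^ j)
    (j : ℕ) {x : PadicAlgCl 2} (hx : x ∈ layer 2 m) :
    g₀ ^ j • x = τ ((5 : ZMod (2 ^ m)) ^ j) • x := by
  refine LocalVar.smul_eq_smul_of_smul_zeta_eq 2 ?_ hx
  have h5 : IsUnit ((5 : ZMod (2 ^ m)) ^ j) := by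
    refine IsUnit.pow j ?_
    have h : ((5 : ℕ) : ZMod (2 ^ m)) = 5 := by norm_cast
    rw [← h, ZMod.isUnit_iff_coprime]
    exact Nat.Coprime.pow_right _ (by norm_num)
  rw [hg₀ j, hτ _ h5]
  have hval : ((5 : ZMod (2 ^ m)) ^ j).val = 5 ^ j % 2 ^ m := by
    have h : ((5 ^ j : ℕ) : ZMod (2 ^ m)) = (5 : ZMod (2 ^ m)) ^ j := by push_cast; ring
    rw [← h, ZMod.val_natCast]
  rw [hval, ← zeta_pow_eq_pow_mod]

variable (W : WeierstrassCurve ℚ) [W.IsGloballyMinimal]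
  {κ : ZpExtension ℚ 2} (ι : AlgebraicClosure ℚ →ₐ[ℚ] AlgebraicClosure ℚ_[2])

/-- **The logarithm of a point of `E(ℚ_{2,n})` is fixed by `Gal(ℚ̄₂/ℚ_{2,n})`**: for `Q ∈ E(ℚ_{2,n})` (`localLayerPointsOfEmb κ ι W n`) with
`T⁻¹Q ∈ E₁` and `ρ ∈ Gal(ℚ̄₂/ℚ_{2,n})` (`localLayerSubgroupOfEmb κ ι n`), `ρ • Λ(T⁻¹Q) = Λ(T⁻¹Q)`. [cite: Kobayashi2003, §8.4] -/
theorem smul_ptLogΩ_eq_self_of_mem (n : ℕ) (Q : localPoints W ℚ_[2]) (hQn : Q ∈ localLayerPointsOfEmb κ ι W n)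
    (hQ : haveI := isIntegral_genFib_baseChange 2 ((integralModelInt W).map (Int.castRingHom ℤ_[2]))
      (toLoc ((genFibΩ_eq_baseChange ((integralModelInt W).map (Int.castRingHom ℤ_[2]))).trans
        (baseChange_twoAdicModel W))).symm Q ∈
        kernel (Valued.v (R := PadicAlgCl 2)) (genFibΩ 2 ((integralModelInt W).map (Int.castRingHom ℤ_[2]))))
    {ρ : Field.absoluteGaloisGroup ℚ_[2]} (hρ : ρ ∈ localLayerSubgroupOfEmb κ ι n) :
    haveI := isIntegral_genFib_baseChange 2 ((integralModelInt W).map (Int.castRingHom ℤ_[2]))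
    ρ • ptLogΩ 2 ((integralModelInt W).map (Int.castRingHom ℤ_[2]))
        ((toLoc ((genFibΩ_eq_baseChange ((integralModelInt W).map (Int.castRingHom ℤ_[2]))).trans
          (baseChange_twoAdicModel W))).symm Q) =
      ptLogΩ 2 ((integralModelInt W).map (Int.castRingHom ℤ_[2]))
        ((toLoc ((genFibΩ_eq_baseChange ((integralModelInt W).map (Int.castRingHom ℤ_[2]))).trans
          (baseChange_twoAdicModel W))).symm Q) := by
  have hfix : ρ • Q = Q := (mem_localLayerPointsOfEmb_iff κ ι W n Q).mp hQn ρ hρ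
  rw [← ptLogΩ_toLoc_symm_smul W ρ Q hQ, hfix]

/-- **The logarithm of a point of `E(ℚ_{2,n})` lies in `ℚ₂(ζ_{2^{n+2}}) = layer 2 (n+2)`** (it is fixed by `Stab ζ_{2^{n+2}} ≤ Gal(ℚ̄₂/ℚ_{2,n})`;
Galois correspondence `mem_layer_iff_forall_smul_eq`). [cite: Kobayashi2003, §8.4] [cite: Washington1997, §13.1] -/
theorem ptLogΩ_mem_layer (hκ : κ.IsCyclotomic) (n : ℕ) (Q : localPoints W ℚ_[2]) (hQn : Q ∈ localLayerPointsOfEmb κ ι W n)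
    (hQ : haveI := isIntegral_genFib_baseChange 2 ((integralModelInt W).map (Int.castRingHom ℤ_[2]))
      (toLoc ((genFibΩ_eq_baseChange ((integralModelInt W).map (Int.castRingHom ℤ_[2]))).trans
        (baseChange_twoAdicModel W))).symm Q ∈
        kernel (Valued.v (R := PadicAlgCl 2)) (genFibΩ 2 ((integralModelInt W).map (Int.castRingHom ℤ_[2])))) :
    haveI := isIntegral_genFib_baseChange 2 ((integralModelInt W).map (Int.castRingHom ℤ_[2]))
    ptLogΩ 2 ((integralModelInt W).map (Int.castRingHom ℤ_[2]))
        ((toLoc ((genFibΩ_eq_baseChange ((integralModelInt W).map (Int.castRingHom ℤ_[2]))).trans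
          (baseChange_twoAdicModel W))).symm Q) ∈ layer 2 (n + 2) := by
  rw [mem_layer_iff_forall_smul_eq]
  intro σ hσ
  exact smul_ptLogΩ_eq_self_of_mem W ι n Q hQn hQ (SignedEC.PlusLayer.stab_le_localLayerSubgroupOfEmb_two ι hκ n hσ)

/-- **`τ_{−a} • L = τ_a • L`** for the logarithm `L` of a point of `E(ℚ_{2,n})`: `τ_a⁻¹ τ_{−a}` inverts `ζ_{2^{n+2}}`, hence lies in
`Gal(ℚ̄₂/ℚ_{2,n})` (`mem_localLayerSubgroupOfEmb_two_iff_zeta`) and fixes `L`. [cite: Washington1997, §13.1] [cite: Kobayashi2003, §8.4] -/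
theorem tau_neg_smul_ptLogΩ_eq (hκ : κ.IsCyclotomic) (n : ℕ) [NeZero (2 ^ (n + 2))] (τ : ZMod (2 ^ (n + 2)) → Field.absoluteGaloisGroup ℚ_[2])
    (hτ : ∀ a : ZMod (2 ^ (n + 2)), IsUnit a → τ a • zeta 2 (n + 2) = zeta 2 (n + 2) ^ a.val)
    {a : ZMod (2 ^ (n + 2))} (ha : IsUnit a)
    (Q : localPoints W ℚ_[2]) (hQn : Q ∈ localLayerPointsOfEmb κ ι W n)
    (hQ : haveI := isIntegral_genFib_baseChange 2 ((integralModelInt W).map (Int.castRingHom ℤ_[2]))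
      (toLoc ((genFibΩ_eq_baseChange ((integralModelInt W).map (Int.castRingHom ℤ_[2]))).trans
        (baseChange_twoAdicModel W))).symm Q ∈
        kernel (Valued.v (R := PadicAlgCl 2)) (genFibΩ 2 ((integralModelInt W).map (Int.castRingHom ℤ_[2])))) :
    haveI := isIntegral_genFib_baseChange 2 ((integralModelInt W).map (Int.castRingHom ℤ_[2]))
    τ (-a) • ptLogΩ 2 ((integralModelInt W).map (Int.castRingHom ℤ_[2]))
        ((toLoc ((genFibΩ_eq_baseChange ((integralModelInt W).map (Int.castRingHom ℤ_[2]))).trans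
          (baseChange_twoAdicModel W))).symm Q) =
      τ a • ptLogΩ 2 ((integralModelInt W).map (Int.castRingHom ℤ_[2]))
        ((toLoc ((genFibΩ_eq_baseChange ((integralModelInt W).map (Int.castRingHom ℤ_[2]))).trans
          (baseChange_twoAdicModel W))).symm Q) := by
  -- `ρ := (τ a)⁻¹ * τ (−a)` inverts `ζ_{2^{n+2}}`
  have hX : τ (-a) • zeta 2 (n + 2) = (zeta 2 (n + 2) ^ a.val)⁻¹ := by
    rw [hτ (-a) ha.neg]
    refine eq_inv_of_mul_eq_one_left ?_
    rw [← pow_add, zeta_pow_eq_pow_mod, ← ZMod.val_add, neg_add_cancel, ZMod.val_zero, pow_zero]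
  have hinv : ((τ a)⁻¹ * τ (-a)) • zeta 2 (n + 2) = (zeta 2 (n + 2))⁻¹ := by
    rw [mul_smul, hX, ← hτ a ha, ← smul_inv'', inv_smul_smul]
  have hρ : (τ a)⁻¹ * τ (-a) ∈ localLayerSubgroupOfEmb κ ι n :=
    (SignedEC.PlusLayer.mem_localLayerSubgroupOfEmb_two_iff_zeta ι hκ n _).mpr (Or.inr hinv)
  have hfix := smul_ptLogΩ_eq_self_of_mem W ι n Q hQn hQ hρ
  rw [mul_smul] at hfix
  conv_lhs => rw [← smul_inv_smul (τ a) (τ (-a) • ptLogΩ 2 ((integralModelInt W).map (Int.castRingHom ℤ_[2]))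
    ((toLoc ((genFibΩ_eq_baseChange ((integralModelInt W).map (Int.castRingHom ℤ_[2]))).trans
      (baseChange_twoAdicModel W))).symm Q)), hfix]

end Layer

/-! ## §3 The factorisation (Kobayashi Prop. 8.25 in the `⟨5⟩`-enumeration) -/

section Factorisation

/-- `5ʲ` is a unit modulo `2^m`. [folklore] -/
theorem isUnit_five_pow (m j : ℕ) : IsUnit ((5 : ZMod (2 ^ m)) ^ j) := by
  refine IsUnit.pow j ?_
  have h : ((5 : ℕ) : ZMod (2 ^ m)) = 5 := by norm_cast
  rw [← h, ZMod.isUnit_iff_coprime]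
  exact Nat.Coprime.pow_right _ (by norm_num)

/-- **The `P`-side factorisation (Kobayashi 2003, Prop. 8.25, `⟨5⟩`-enumerated).** Let `m = n + 2`, `τ_a ∈ Γ_{ℚ₂}` with
`τ_a ζ_{2^m} = ζ_{2^m}^a` on units, `g₀` with `g₀ʲ ζ_{2^m} = ζ_{2^m}^{5ʲ}`, `L₀, E ∈ ℚ₂(ζ_{2^m})` with `τ_{−a}•L₀ = τ_a•L₀` (i.e. `L₀ ∈ ℚ_{2,n}`),
and `ψ` an EVEN Dirichlet character mod `2^m` with values in `ℚ̄₂`. Then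
`Σ_{s mod 2ⁿ} ψ(5)^s · Σ_{b ∈ (ℤ/2^m)ˣ} τ_b•(g₀^s•L₀ · E) = (Σ_{s mod 2ⁿ} ψ(5)^s · g₀^s•L₀) · Σ_{b ∈ (ℤ/2^m)ˣ} ψ̄(b) · τ_b•E` —
the trace `Tr_{ℚ₂(ζ)/ℚ₂}(g₀^s L₀ · E) = Σ_b τ_b•(…)` against the orbit of `L₀` factors as (log character sum) × (exp* character sum).
Proof: both sides, doubled, equal `Σ_a ψ(a)·Σ_b (τ_bτ_a•L₀)(τ_b•E)` (units `= ±5^s`, w2's `HondaLogChi.sum_mulChar_eq_sum_pow_five_of_even`,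
used twice; reindex `a ↦ ba`). [cite: Kobayashi2003, Prop. 8.25 (p. 24), (8.23)] -/
theorem sum_pow_mul_trace_eq_mul (n : ℕ) [NeZero (2 ^ (n + 2))] [NeZero (2 ^ n)]
    (τ : ZMod (2 ^ (n + 2)) → Field.absoluteGaloisGroup ℚ_[2])
    (hτ : ∀ a : ZMod (2 ^ (n + 2)), IsUnit a → τ a • zeta 2 (n + 2) = zeta 2 (n + 2) ^ a.val)
    {g₀ : Field.absoluteGaloisGroup ℚ_[2]} (hg₀ : ∀ j : ℕ, g₀ ^ j • zeta 2 (n + 2) = zeta 2 (n + 2) ^ 5 ^ j)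
    {L₀ E : PadicAlgCl 2} (hL₀ : L₀ ∈ layer 2 (n + 2))
    (hLneg : ∀ a : ZMod (2 ^ (n + 2)), IsUnit a → τ (-a) • L₀ = τ a • L₀)
    (ψ : DirichletCharacter (PadicAlgCl 2) (2 ^ (n + 2))) (hψ : ψ (-1) = 1) :
    ∑ s : ZMod (2 ^ n), ψ 5 ^ s.val * ∑ b : (ZMod (2 ^ (n + 2)))ˣ, τ (b : ZMod (2 ^ (n + 2))) • (g₀ ^ s.val • L₀ * E) =
      (∑ s : ZMod (2 ^ n), ψ 5 ^ s.val * g₀ ^ s.val • L₀) *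
        ∑ b : (ZMod (2 ^ (n + 2)))ˣ, ψ⁻¹ (b : ZMod (2 ^ (n + 2))) * τ (b : ZMod (2 ^ (n + 2))) • E := by
  classical
  -- the doubled sum `Σ_a ψ(a) G(a)`
  set G : ZMod (2 ^ (n + 2)) → PadicAlgCl 2 :=
    fun a ↦ ∑ b : (ZMod (2 ^ (n + 2)))ˣ, τ (b : ZMod (2 ^ (n + 2))) • (τ a • L₀) * τ (b : ZMod (2 ^ (n + 2))) • E with hG
  have hG5 : ∀ s : ZMod (2 ^ n), G ((5 : ZMod (2 ^ (n + 2))) ^ s.val) =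
      ∑ b : (ZMod (2 ^ (n + 2)))ˣ, τ (b : ZMod (2 ^ (n + 2))) • (g₀ ^ s.val • L₀ * E) := by
    intro s
    simp only [hG]
    refine Finset.sum_congr rfl fun b _ ↦ ?_
    rw [smul_mul', pow_smul_eq_tau_smul τ hτ hg₀ s.val hL₀]
  have hGneg : ∀ s : ZMod (2 ^ n), G (-(5 : ZMod (2 ^ (n + 2))) ^ s.val) = G ((5 : ZMod (2 ^ (n + 2))) ^ s.val) := by
    intro s
    simp only [hG]
    refine Finset.sum_congr rfl fun b _ ↦ ?_
    rw [hLneg _ (isUnit_five_pow (n + 2) s.val)]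
  -- (1) enumerate `a = ±5^s`
  have h1 : ∑ a : ZMod (2 ^ (n + 2)), ψ a * G a =
      2 * ∑ s : ZMod (2 ^ n), ψ 5 ^ s.val *
        ∑ b : (ZMod (2 ^ (n + 2)))ˣ, τ (b : ZMod (2 ^ (n + 2))) • (g₀ ^ s.val • L₀ * E) := by
    rw [HondaLogChi.sum_mulChar_eq_sum_pow_five_of_even n ψ hψ G, Finset.mul_sum]
    refine Finset.sum_congr rfl fun s _ ↦ ?_
    rw [hGneg, hG5, map_pow]
    ring
  -- (2) swap the sums and reindex `a ↦ b·a`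
  have hre : ∀ b : (ZMod (2 ^ (n + 2)))ˣ,
      ∑ a : ZMod (2 ^ (n + 2)), ψ a * (τ (b : ZMod (2 ^ (n + 2))) • (τ a • L₀) * τ (b : ZMod (2 ^ (n + 2))) • E) =
        ψ⁻¹ (b : ZMod (2 ^ (n + 2))) * τ (b : ZMod (2 ^ (n + 2))) • E *
          ∑ a : ZMod (2 ^ (n + 2)), ψ a * τ a • L₀ := by
    intro b
    have hb : IsUnit (b : ZMod (2 ^ (n + 2))) := Units.isUnit b
    have step : ∀ a : ZMod (2 ^ (n + 2)),
        ψ a * (τ (b : ZMod (2 ^ (n + 2))) • (τ a • L₀) * τ (b : ZMod (2 ^ (n + 2))) • E) =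
          τ (b : ZMod (2 ^ (n + 2))) • E * (ψ a * τ ((b : ZMod (2 ^ (n + 2))) * a) • L₀) := by
      intro a
      by_cases ha : IsUnit a
      · rw [smul_smul_eq_smul_mul τ hτ ha hb hL₀]; ring
      · rw [MulChar.map_nonunit ψ ha, zero_mul, zero_mul, mul_zero]
    simp_rw [step]
    rw [← Finset.mul_sum]
    -- reindex `a ↦ b * a`
    have hsum : ∑ a : ZMod (2 ^ (n + 2)), ψ a * τ ((b : ZMod (2 ^ (n + 2))) * a) • L₀ =
        ψ⁻¹ (b : ZMod (2 ^ (n + 2))) * ∑ a : ZMod (2 ^ (n + 2)), ψ a * τ a • L₀ := by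
      rw [Finset.mul_sum]
      have hψb : ψ⁻¹ (b : ZMod (2 ^ (n + 2))) * ψ (b : ZMod (2 ^ (n + 2))) = 1 := by
        rw [← MulChar.mul_apply, inv_mul_cancel, MulChar.one_apply hb]
      have key : ∀ a : ZMod (2 ^ (n + 2)),
          ψ a * τ ((b : ZMod (2 ^ (n + 2))) * a) • L₀ =
            ψ⁻¹ (b : ZMod (2 ^ (n + 2))) * (ψ ((b : ZMod (2 ^ (n + 2))) * a) * τ ((b : ZMod (2 ^ (n + 2))) * a) • L₀) := by
        intro a
        rw [map_mul, mul_assoc, ← mul_assoc (ψ⁻¹ (b : ZMod (2 ^ (n + 2)))), hψb, one_mul]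
      simp_rw [key]
      exact (Equiv.sum_comp (Units.mulLeft b) (fun a ↦ ψ⁻¹ (b : ZMod (2 ^ (n + 2))) * (ψ a * τ a • L₀)))
    rw [hsum]
    ring
  have h2 : ∑ a : ZMod (2 ^ (n + 2)), ψ a * G a =
      (∑ a : ZMod (2 ^ (n + 2)), ψ a * τ a • L₀) *
        ∑ b : (ZMod (2 ^ (n + 2)))ˣ, ψ⁻¹ (b : ZMod (2 ^ (n + 2))) * τ (b : ZMod (2 ^ (n + 2))) • E := by
    simp only [hG, Finset.mul_sum]
    rw [Finset.sum_comm]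
    simp_rw [hre]
    refine Finset.sum_congr rfl fun b _ ↦ ?_
    ring
  -- (3) the log sum, enumerated
  have h3 : ∑ a : ZMod (2 ^ (n + 2)), ψ a * τ a • L₀ = 2 * ∑ s : ZMod (2 ^ n), ψ 5 ^ s.val * g₀ ^ s.val • L₀ := by
    rw [HondaLogChi.sum_mulChar_eq_sum_pow_five_of_even n ψ hψ (fun a ↦ τ a • L₀), Finset.mul_sum]
    refine Finset.sum_congr rfl fun s _ ↦ ?_
    rw [hLneg _ (isUnit_five_pow (n + 2) s.val), ← pow_smul_eq_tau_smul τ hτ hg₀ s.val hL₀, map_pow]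
    ring
  -- conclude: cancel the factor `2`
  have h12 := h1.symm.trans h2
  rw [h3, mul_assoc] at h12
  exact mul_left_cancel₀ (two_ne_zero' (PadicAlgCl 2)) h12

end Factorisation

end Summit.BirchSwinnertonDyer.BirchSwinnertonDyer.Theorems.SignedKatoOffTwo.KatoBK

end
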